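import Summits.MatrixMultiplication.OmegaCensus.STPP222Pow6From290

/-!
# ω-census, `N₆` assembly with SEEDS: the seeded route checker `covered6S` and the generic assembly

HONEST FRAMING (pub-omega census; verbatim): lottery ticket; floor = certified bounds/negative ranges.
Census STRUCTURE bookkeeping (question Q7 of the pub-omega cell, the uniform threshold `N₆` for six simultaneous-TPP triples of
2-subsets, CKSU 2005 Def. 5.1, tree form `IsSTPP`), not progress on `ω`: a `(2,2,2)⁶` family certifies no matrix-multiplication
bound of interest.

`STPP222Pow6Routes.lean` / `STPP222Pow6From290.lean` prove `N₆ ≤ 290` with the seedless route checker `covered6`; `290 = 1 + |ℤ/17²|`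
is only the largest abelian type WITHOUT A ROUTE, and every unrouted type is a FIND cell.  This file is the seeded twin, written
once and for all thresholds (the `k = 6` analogue of the seed route (R2) of `STPP222Pow5From94Routes.covered5`):

* `covered6S seeds M := covered6 M || seeds.any (dom · M)` — the landed checker, or `M` dominates one of the seed SHAPES (lists of
  prime-power moduli `s`; `SeedType s = ℤ/s₁ × (ℤ/s₂ × ⋯)`), and `covered6S_sound`: if every seed shape hosts `(2,2,2)⁶` then a block
  whose moduli pass `covered6S` carries `(2,2,2)⁶` (`covered6_sound` + the kit's `hasPow_of_dom`);
* `capListW cap E` — the capping multiset of an exponent `E ≤ 167` for an arbitrary cap function;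
* `exists_isSTPP_222pow6_of_card_ge_of_seededDecision` — **for ANY threshold `T`, seed list and cap function: if the seed shapes host
  `(2,2,2)⁶`, the caps satisfy `v ^ cap-count ≥ T`, and the (kernel) decision "every capped multiset of product `≥ T` is `covered6S`"
  holds for all exponents `E ≤ 167`, `E ≠ 128`, then EVERY finite abelian group of order `≥ T` admits `(2,2,2)⁶`** — the proof of
  `N6From290.exists_isSTPP_222pow6_of_card_ge290` with its three computations turned into hypotheses (exponent `≥ 168`: the cyclic
  law of `STPP222PowCyclicThreeAPFree.lean`; exponent `128`: the kernel witness `ℤ/128`; otherwise structure theorem, capping,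
  decision, soundness on the sub-block, transport).

A concrete threshold file (`STPP222Pow6From<T>.lean`) then only lists its seeds with their kernel witnesses and runs `decide`.
Exact Python mirror of the checker: the seat's `model6s.py` (HOME `pub-omega-stpp-3-g12/code/`).

References: H. Cohn, R. Kleinberg, B. Szegedy, C. Umans, FOCS 2005 (arXiv:math/0511460), Def. 5.1; J. Blasiak et al., Discrete
Analysis 2017:3, Def. 3.1.  Seat pub-omega-stpp-3 (gen 12), 2026-08-25.
-/

open Literature.Computability.AlgebraicComplexity Literature.Combinatorics.Additive Finset

namespace Summit.MatrixMultiplication.OmegaCensus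

namespace N6Seeded

open N5Kit N5From94 N6From290

/-! ## 1. The seeded route checker and its soundness -/

/-- **The seeded route checker for `(2,2,2)⁶`**: the landed seedless checker `covered6` (routes (R1)/(R3) of
`STPP222Pow6Routes.lean`), or `M` dominates one of the seed shapes. -/
def covered6S (seeds : List (List ℕ)) (M : Multiset ℕ) : Bool :=
  covered6 M || seeds.any fun s => dom s M

/-- `covered6` implies `covered6S` (any seed list). -/
theorem covered6S_of_covered6 (seeds : List (List ℕ)) {M : Multiset ℕ} (h : covered6 M = true) :
    covered6S seeds M = true := by
  rw [covered6S, h, Bool.true_or]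

variable {ι : Type} [Fintype ι] [DecidableEq ι] {q : ι → ℕ}

/-- **Soundness of the seeded route checker**: if every seed shape hosts `(2,2,2)⁶` and the multiset of moduli of a block `S`
passes `covered6S`, then `(2,2,2)⁶ ⊆ Π j, ℤ/q j`. [cite: CohnKleinbergSzegedyUmans2005, Def. 5.1] -/
theorem covered6S_sound {seeds : List (List ℕ)} (hseeds : ∀ s ∈ seeds, HasPow (SeedType s) 6) (hq : ∀ i, 0 < q i)
    (S : Finset ι) (h : covered6S seeds (S.val.map q) = true) : HasPow (Π j, ZMod (q j)) 6 := by
  rw [covered6S, Bool.or_eq_true] at h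
  rcases h with h | h
  · exact covered6_sound hq S h
  · rw [List.any_eq_true] at h
    obtain ⟨s, hs, hdom⟩ := h
    exact hasPow_of_dom hq S hdom (hseeds s hs)

/-! ## 2. Capping with an arbitrary cap function -/

/-- For a modulus `E`, the prime powers `≤ 167` dividing `E`, each paired with its cap `cap v`. -/
def capListW (cap : ℕ → ℕ) (E : ℕ) : List (ℕ × ℕ) := (ppList167.filter (· ∣ E)).map fun v => (v, cap v)

/-! ## 3. The generic assembly -/

/-- **Seeded `N₆` assembly, exponents `≤ 167` other than `128`.**  Inputs: the seed shapes host `(2,2,2)⁶` (`hseeds`); the caps are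
large enough (`hcap`: `v ^ (count of v in C_E) ≥ T` for every listed prime power `v ∣ E`); the decision (`hdec`: every sub-multiset
of `C_E` of product `≥ T` is `covered6S`).  Output: every finite abelian group of order `≥ T` and exponent `E ≤ 167`, `E ≠ 128`,
admits `(2,2,2)⁶`.  Structure theorem ⇒ multiset `M` of elementary divisors (prime powers `≤ 167` dividing `E`); `M ∩ C_E` has
product `≥ T` and lies in `subMS`; the decision and `covered6S_sound` on the sub-block carrying `M ∩ C_E`; transport back.
[cite: CohnKleinbergSzegedyUmans2005, Def. 5.1] -/
theorem hasPow6_of_card_ge_of_exponent_le (T : ℕ) (seeds : List (List ℕ)) (cap : ℕ → ℕ)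
    (hseeds : ∀ s ∈ seeds, HasPow (SeedType s) 6)
    (hcap : ∀ E ∈ List.range' 1 167, ∀ v ∈ ppList167, v ∣ E → T ≤ v ^ Multiset.count v (capMS (capListW cap E)))
    (hdec : ∀ E ∈ List.range' 1 167, E ≠ 128 → ∀ M ∈ subMS (capListW cap E), T ≤ M.prod → covered6S seeds M = true)
    {G : Type*} [AddCommGroup G] [Finite G] (hE167 : AddMonoid.exponent G ≤ 167) (h128 : AddMonoid.exponent G ≠ 128)
    (hG : T ≤ Nat.card G) : HasPow G 6 := by
  classical
  obtain ⟨ι, _, p, hp, e, ⟨f₀⟩⟩ := AddCommGroup.equiv_directSum_zmod_of_finite G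
  let f : G ≃+ (Π i, ZMod (p i ^ e i)) :=
    f₀.trans (DirectSum.linearEquivFunOnFintype ℕ ι (fun i => ZMod (p i ^ e i))).toAddEquiv
  set E := AddMonoid.exponent G with hEdef
  have hE1 : 1 ≤ E := Nat.pos_of_ne_zero AddMonoid.exponent_ne_zero_of_finite
  have hq0 : ∀ i, 0 < p i ^ e i := fun i => pow_pos (hp i).pos _
  have hdvd : ∀ i, p i ^ e i ∣ E := fun i => by
    have hinj : Function.Injective (AddMonoidHom.single (fun j => ZMod (p j ^ e j)) i) :=
      Pi.single_injective (M := fun j => ZMod (p j ^ e j)) i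
    have h1 : addOrderOf (f.symm (AddMonoidHom.single (fun j => ZMod (p j ^ e j)) i 1)) = p i ^ e i := by
      rw [AddEquiv.addOrderOf_eq, addOrderOf_injective _ hinj, ZMod.addOrderOf_one]
    rw [← h1]
    exact AddMonoid.addOrder_dvd_exponent _
  set S₀ : Finset ι := Finset.univ.filter fun i => 0 < e i with hS₀
  set M : Multiset ℕ := S₀.val.map (fun i => p i ^ e i) with hM
  have hprod : T ≤ M.prod := by
    have h1 : M.prod = ∏ i, p i ^ e i := by
      rw [hM, N5Kit.prod_map_val]
      exact Finset.prod_filter_of_ne fun i _ hi => Nat.pos_of_ne_zero fun h0 => hi (by rw [h0, pow_zero])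
    have h2 : Nat.card G = ∏ i, p i ^ e i := by
      rw [Nat.card_congr f.toEquiv, Nat.card_pi]
      simp [Nat.card_zmod]
    rw [h1, ← h2]; exact hG
  have hmem : ∀ a ∈ M, a ∈ ppList167 ∧ a ∣ E := by
    intro a ha
    obtain ⟨i, hi, rfl⟩ := Multiset.mem_map.1 ha
    have hi' : 0 < e i := (Finset.mem_filter.1 hi).2
    exact ⟨pow_mem_ppList167 (hp i) hi' (le_trans (Nat.le_of_dvd (by omega) (hdvd i)) (by omega)), hdvd i⟩
  have hEI : E ∈ List.range' 1 167 := List.mem_range'_1.2 ⟨hE1, by omega⟩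
  set C := capMS (capListW cap E) with hC
  have hcapd : T ≤ (M ∩ C).prod := prod_inter_ge_of hprod (fun a ha => one_le_of_mem_ppList167 (hmem a ha).1)
    (fun a ha => hcap E hEI a (hmem a ha).1 (hmem a ha).2)
  have hMC : M ∩ C ∈ subMS (capListW cap E) := mem_subMS_of_le _ _ Multiset.inter_le_right
  have hcov : covered6S seeds (M ∩ C) = true := hdec E hEI h128 (M ∩ C) hMC hcapd
  obtain ⟨S₁, -, hS₁⟩ := exists_subset_map_eq (fun i => p i ^ e i) S₀ (M ∩ C) Multiset.inter_le_left
  rw [← hS₁] at hcov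
  have h6 : HasPow (Π i, ZMod (p i ^ e i)) 6 := covered6S_sound hseeds hq0 S₁ hcov
  exact hasPow_map f.symm.toAddMonoidHom f.symm.injective h6

/-- **Seeded `N₆` assembly (generic threshold).**  For ANY threshold `T`, seed list and cap function: if every seed shape hosts
`(2,2,2)⁶`, the caps satisfy `v ^ cap-count ≥ T` for the prime powers `≤ 167` dividing each exponent `E ≤ 167`, and every capped
multiset of product `≥ T` is `covered6S` for every `E ≤ 167`, `E ≠ 128`, then **every finite abelian group of order `≥ T` admits six
simultaneous-TPP triples of 2-subsets** (CKSU 2005 Def. 5.1, tree form `IsSTPP`).  Exponent `≥ 168`: the cyclic law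
`exists_isSTPP_2226_of_exponent_ge168`; exponent `128`: the kernel witness `ℤ/128 ⊇ (2,2,2)⁶` along `ℤ/(ord g) ↪ G`; otherwise
`hasPow6_of_card_ge_of_exponent_le`.  No sharpness and no `ω` bound claimed. [cite: CohnKleinbergSzegedyUmans2005, Def. 5.1] -/
theorem exists_isSTPP_222pow6_of_card_ge_of_seededDecision (T : ℕ) (seeds : List (List ℕ)) (cap : ℕ → ℕ)
    (hseeds : ∀ s ∈ seeds, HasPow (SeedType s) 6)
    (hcap : ∀ E ∈ List.range' 1 167, ∀ v ∈ ppList167, v ∣ E → T ≤ v ^ Multiset.count v (capMS (capListW cap E)))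
    (hdec : ∀ E ∈ List.range' 1 167, E ≠ 128 → ∀ M ∈ subMS (capListW cap E), T ≤ M.prod → covered6S seeds M = true)
    {G : Type*} [AddCommGroup G] [Finite G] (hG : T ≤ Nat.card G) :
    ∃ A B C : Fin 6 → Finset G, IsSTPP A B C ∧ ∀ i, (A i).card = 2 ∧ (B i).card = 2 ∧ (C i).card = 2 := by
  classical
  by_cases h168 : 168 ≤ AddMonoid.exponent G
  · exact exists_isSTPP_2226_of_exponent_ge168 h168
  by_cases h128 : AddMonoid.exponent G = 128
  · obtain ⟨g, hg⟩ := AddMonoid.exists_addOrderOf_eq_exponent (AddMonoid.ExponentExists.of_finite (G := G))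
    exact exists_isSTPP_222pow_of_injective _ (zmod_lift_zmultiples_injective g) (hasPow6_zmod_of_eq_128 (hg.trans h128))
  exact hasPow6_of_card_ge_of_exponent_le T seeds cap hseeds hcap hdec (by omega) h128 hG

end N6Seeded

end Summit.MatrixMultiplication.OmegaCensus
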